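import Summits.QuantumAdvantage.AdviceFreeQNC0.UCoord39
import Summits.QuantumAdvantage.AdviceFreeQNC0.RingHardOdd
import Summits.QuantumAdvantage.AdviceFreeQNC0.AffBells21Characters
import HarnessLib

/-!
# Tree port (qn-prover-3 g24), PART 2 of planner qa-qnc0-p1 g39's custody file `qa-qnc0-p1/exp39/UCoord39.lean`
# (sha 78b01a24be5be1f9), verbatim; part 1 = `UCoord39.lean`.  See the module docstring of part 1 for the mathematics.
-/

namespace Summit.QuantumAdvantage.AdviceFreeQNC0.UCoord39

open Finset Summit.QuantumAdvantage.AdviceFreeQNC0 Literature.Computability.MetaComplexity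

variable {N : ℕ}

/-- The rest of the phase is blind to the clean coordinates. -/
theorem rest_update (k : ℕ) (r : Fin N → ZMod 3) (a b : ZMod 3) (u : Fin N → Bool) (j : Fin N)
    (hj : Clean k r j) (c : Bool) : rest k r a b (Function.update u j c) = rest k r a b u := by
  unfold rest
  congr 1
  · refine Finset.sum_congr rfl fun i _ => ?_
    by_cases hij : i = j
    · subst hij
      simp [hj]
    · rw [Function.update_of_ne hij]
  · congr 1
    unfold linVal
    refine Finset.sum_congr rfl fun i _ => ?_
    by_cases hri : r i = 0
    · simp [hri]
    · have hij : i ≠ j := fun h => hri (h ▸ hj.2.1)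
      have hx : xOfU (Function.update u j c) i = xOfU u i := by
        apply xOfU_congr _ _ i (Function.update_of_ne hij c u)
        intro i' hi'
        have hne : i' ≠ j := fun h => hri (hj.2.2 i (h ▸ hi'))
        exact Function.update_of_ne hne c u
      rw [hx]

/-! ### Counting the clean coordinates -/

/-- Splitting off the last index of a prefix count (copy of the private lemma in `WalkCoordinates`). -/
theorem card_filter_lt_succ (p : Fin N → Prop) [DecidablePred p] {k : ℕ} (hk : k < N) :
    (univ.filter fun j : Fin N => j.val < k + 1 ∧ p j).card =
      (univ.filter fun j : Fin N => j.val < k ∧ p j).card + (if p ⟨k, hk⟩ then 1 else 0) := by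
  have hsplit : (univ.filter fun j : Fin N => j.val < k + 1 ∧ p j) =
      (univ.filter fun j : Fin N => j.val < k ∧ p j) ∪
        (univ.filter fun j : Fin N => j = ⟨k, hk⟩ ∧ p j) := by
    ext j
    simp only [mem_filter, mem_univ, true_and, mem_union]
    constructor
    · rintro ⟨hj, hp⟩
      by_cases h : j.val < k
      · exact Or.inl ⟨h, hp⟩
      · exact Or.inr ⟨Fin.ext (by simp; omega), hp⟩
    · rintro (⟨hj, hp⟩ | ⟨rfl, hp⟩)
      · exact ⟨by omega, hp⟩
      · exact ⟨by simp, hp⟩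
  rw [hsplit, card_union_of_disjoint]
  · congr 1
    by_cases hp : p ⟨k, hk⟩
    · rw [if_pos hp]
      have : (univ.filter fun j : Fin N => j = ⟨k, hk⟩ ∧ p j) = {⟨k, hk⟩} := by
        ext j
        simp only [mem_filter, mem_univ, true_and, mem_singleton]
        exact ⟨fun h => h.1, fun h => ⟨h, h ▸ hp⟩⟩
      rw [this, card_singleton]
    · rw [if_neg hp]
      have : (univ.filter fun j : Fin N => j = ⟨k, hk⟩ ∧ p j) = ∅ := by
        ext j
        simp only [mem_filter, mem_univ, true_and, Finset.notMem_empty, iff_false, not_and]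
        rintro rfl; exact hp
      rw [this, card_empty]
  · rw [Finset.disjoint_filter]
    rintro j _ ⟨hj, _⟩ ⟨rfl, _⟩
    simp at hj

/-- `Clean k r j = (j < k) ∧ Q r j` with `Q` independent of `k`. -/
def CleanQ (r : Fin N → ZMod 3) (j : Fin N) : Prop := r j = 0 ∧ ∀ j' : Fin N, j'.val = j.val + 1 → r j' = 0

/-- decidability instance `instDecCleanQ` (planner p1 g39, exp39; ported verbatim). -/
instance instDecCleanQ (r : Fin N → ZMod 3) : DecidablePred (CleanQ r) := by
  intro j; unfold CleanQ; infer_instance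

/-- auxiliary lemma `filter_clean_eq` (planner p1 g39, exp39; ported verbatim). -/
theorem filter_clean_eq (k : ℕ) (r : Fin N → ZMod 3) :
    univ.filter (Clean k r) = univ.filter (fun j : Fin N => j.val < k ∧ CleanQ r j) := by
  ext j; simp [Clean, CleanQ]

/-- The potential-function count: `k ≤ #clean + #{i<k : r_i ≠ 0} + #{i<k+1 : r_i ≠ 0}` for `k ≤ N`. -/
theorem count_clean (r : Fin N → ZMod 3) :
    ∀ k, k ≤ N → k ≤ (univ.filter (Clean k r)).card
      + (univ.filter fun i : Fin N => i.val < k ∧ r i ≠ 0).card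
      + (univ.filter fun i : Fin N => i.val < k + 1 ∧ r i ≠ 0).card := by
  intro k
  induction k with
  | zero => intro _; exact Nat.zero_le _
  | succ k ih =>
    intro hk
    have hkN : k < N := by omega
    have ih' := ih (by omega)
    rw [filter_clean_eq] at ih' ⊢
    rw [card_filter_lt_succ (CleanQ r) hkN, card_filter_lt_succ (fun i => r i ≠ 0) hkN]
    -- the look-ahead count
    have hlook : (univ.filter fun i : Fin N => i.val < k + 1 + 1 ∧ r i ≠ 0).card
        = (univ.filter fun i : Fin N => i.val < k + 1 ∧ r i ≠ 0).card
          + (if h : k + 1 < N then (if r ⟨k + 1, h⟩ ≠ 0 then 1 else 0) else 0) := by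
      by_cases h : k + 1 < N
      · rw [dif_pos h, card_filter_lt_succ (fun i => r i ≠ 0) h]
      · rw [dif_neg h, add_zero]
        congr 1
        ext i
        simp only [mem_filter, mem_univ, true_and]
        constructor
        · rintro ⟨_, hr⟩; exact ⟨by omega, hr⟩
        · rintro ⟨_, hr⟩; exact ⟨by omega, hr⟩
    rw [hlook]
    -- case analysis on the three indicators
    by_cases hr : r ⟨k, hkN⟩ ≠ 0
    · rw [if_pos hr]
      have := ih'
      split_ifs <;> omega
    · push Not at hr
      by_cases hq : CleanQ r ⟨k, hkN⟩
      · rw [if_pos hq, if_neg (by simpa using hr)]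
        split_ifs <;> omega
      · -- not clean although r_k = 0: then k+1 < N and r_{k+1} ≠ 0
        have hex : ∃ h : k + 1 < N, r ⟨k + 1, h⟩ ≠ 0 := by
          unfold CleanQ at hq
          push Not at hq
          obtain ⟨j', hj', hrj'⟩ := hq hr
          have hlt : k + 1 < N := by have := j'.isLt; simp at hj'; omega
          refine ⟨hlt, ?_⟩
          have : j' = ⟨k + 1, hlt⟩ := Fin.ext (by simpa using hj')
          rw [← this]; exact hrj'
        obtain ⟨hlt, hr1⟩ := hex
        rw [if_neg hq, if_neg (by simpa using hr), dif_pos hlt, if_pos hr1]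
        omega

/-- The usable form: `k − 2 s' ≤ #clean + 1`. -/
theorem sub_le_card_clean (r : Fin N → ZMod 3) (k : ℕ) (hk : k ≤ N) :
    k - 2 * (univ.filter fun i : Fin N => i.val < k ∧ r i ≠ 0).card ≤ (univ.filter (Clean k r)).card + 1 := by
  have h := count_clean r k hk
  have hlook : (univ.filter fun i : Fin N => i.val < k + 1 ∧ r i ≠ 0).card
      ≤ (univ.filter fun i : Fin N => i.val < k ∧ r i ≠ 0).card + 1 := by
    by_cases hkN : k < N
    · rw [card_filter_lt_succ (fun i => r i ≠ 0) hkN]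
      split_ifs <;> omega
    · have : (univ.filter fun i : Fin N => i.val < k + 1 ∧ r i ≠ 0) = (univ.filter fun i : Fin N => i.val < k ∧ r i ≠ 0) := by
        ext i
        simp only [mem_filter, mem_univ, true_and]
        constructor
        · rintro ⟨_, hr⟩; exact ⟨by omega, hr⟩
        · rintro ⟨_, hr⟩; exact ⟨by omega, hr⟩
      rw [this]; omega
  omega

/-! ### The theorem -/

/-- **Lemma B″ = `Blind39.LinBlindness` (v2).**  For `a ≠ 0` and `k ≤ N`:
`‖Σ_x ω^{a·W_k(x) + b·⟨r,x⟩}‖ ≤ 4·2^N / 2^{k − 2 s'}`, `s' = #{i < k : r_i ≠ 0}`.  (Proof: ROUND-38 §2, u-coordinates +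
Fubini over the clean coordinates; the constant proved is in fact `2`.) -/
theorem linBlindness (N k : ℕ) (r : Fin N → ZMod 3) (a b : ZMod 3) (ha : a ≠ 0) (hk : k ≤ N) :
    ‖∑ x : Fin N → Bool, (ZMod.stdAddChar (a * ((Wk x k : ℕ) : ZMod 3) + b * linVal r x) : ℂ)‖
      ≤ 4 * (2 : ℝ) ^ N / (2 : ℝ) ^ (k - 2 * (univ.filter fun i : Fin N => i.val < k ∧ r i ≠ 0).card) := by
  set Cl := univ.filter (Clean k r) with hCl
  set φ : Bool → ℂ := fun c => if c then (ZMod.stdAddChar a : ℂ) else 1 with hφ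
  rw [sum_eq_sum_xOfU]
  have hF : ∀ u : Fin N → Bool,
      (ZMod.stdAddChar (a * ((Wk (xOfU u) k : ℕ) : ZMod 3) + b * linVal r (xOfU u)) : ℂ)
        = (∏ i ∈ Cl, φ (u i)) * (ZMod.stdAddChar (rest k r a b u) : ℂ) := by
    intro u
    rw [Wk_xOfU, phase_split, AddChar.map_add_eq_mul, std_cleanPart]
  rw [Fintype.sum_congr _ _ hF]
  have h1 := norm_sum_prod_coord_le Cl φ (fun u => (ZMod.stdAddChar (rest k r a b u) : ℂ))
    (fun u j c hj => by
      have hj' : Clean k r j := by rw [hCl, mem_filter] at hj; exact hj.2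
      show (ZMod.stdAddChar (rest k r a b (Function.update u j c)) : ℂ) = ZMod.stdAddChar (rest k r a b u)
      rw [rest_update k r a b u j hj' c])
    (fun u => le_of_eq (AffBells21.norm_stdAddChar_three _))
  have hφ1 : ‖φ true + φ false‖ ≤ 1 := by
    show ‖(if true then (ZMod.stdAddChar a : ℂ) else 1) + (if false then (ZMod.stdAddChar a : ℂ) else 1)‖ ≤ 1
    rw [if_pos rfl, if_neg Bool.false_ne_true, add_comm]
    have h := TwoModuli.norm_one_add_stdAddChar_le (p := 3) ha
    have hcos : Real.cos (Real.pi / ((3 : ℕ) : ℝ)) = 1 / 2 := by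
      rw [show ((3 : ℕ) : ℝ) = 3 by norm_num, Real.cos_pi_div_three]
    rw [hcos] at h
    linarith
  have hpow : ‖φ true + φ false‖ ^ Cl.card ≤ 1 := pow_le_one₀ (norm_nonneg _) hφ1
  have h2 : ‖∑ u : Fin N → Bool, (∏ i ∈ Cl, φ (u i)) * (ZMod.stdAddChar (rest k r a b u) : ℂ)‖
      ≤ (2 : ℝ) ^ N / (2 : ℝ) ^ Cl.card := by
    refine h1.trans ?_
    rw [mul_div_assoc]
    have hnn : (0 : ℝ) ≤ (2 : ℝ) ^ N / (2 : ℝ) ^ Cl.card := by positivity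
    calc ‖φ true + φ false‖ ^ Cl.card * ((2 : ℝ) ^ N / (2 : ℝ) ^ Cl.card)
        ≤ 1 * ((2 : ℝ) ^ N / (2 : ℝ) ^ Cl.card) := mul_le_mul_of_nonneg_right hpow hnn
      _ = (2 : ℝ) ^ N / (2 : ℝ) ^ Cl.card := one_mul _
  refine h2.trans ?_
  have hcount := sub_le_card_clean r k hk
  rw [← hCl] at hcount
  have hA : (0 : ℝ) < (2 : ℝ) ^ Cl.card := by positivity
  have hB : (0 : ℝ) < (2 : ℝ) ^ (k - 2 * (univ.filter fun i : Fin N => i.val < k ∧ r i ≠ 0).card) := by positivity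
  rw [div_le_div_iff₀ hA hB]
  have hp : (2 : ℝ) ^ (k - 2 * (univ.filter fun i : Fin N => i.val < k ∧ r i ≠ 0).card) ≤ (2 : ℝ) ^ (Cl.card + 2) :=
    pow_le_pow_right₀ (by norm_num) (by omega)
  have h2N : (0 : ℝ) ≤ (2 : ℝ) ^ N := by positivity
  calc (2 : ℝ) ^ N * (2 : ℝ) ^ (k - 2 * (univ.filter fun i : Fin N => i.val < k ∧ r i ≠ 0).card)
      ≤ (2 : ℝ) ^ N * (2 : ℝ) ^ (Cl.card + 2) := mul_le_mul_of_nonneg_left hp h2N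
    _ = 4 * (2 : ℝ) ^ N * (2 : ℝ) ^ Cl.card := by ring

end Summit.QuantumAdvantage.AdviceFreeQNC0.UCoord39

/-! ## Sanity: the statement proved is `Blind39.LinBlindness` (v2) verbatim, over this file's `linVal`. -/
namespace Summit.QuantumAdvantage.AdviceFreeQNC0.UCoord39

/-- `Blind39.LinBlindness` (v2) restated here (Blind39.lean is a sibling custody file and cannot be imported). -/
def LinBlindness : Prop :=
  ∀ (N k : ℕ) (r : Fin N → ZMod 3) (a b : ZMod 3), a ≠ 0 → k ≤ N →
    ‖∑ x : Fin N → Bool, (ZMod.stdAddChar (a * ((Wk x k : ℕ) : ZMod 3) + b * linVal r x) : ℂ)‖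
      ≤ 4 * (2 : ℝ) ^ N / (2 : ℝ) ^ (k - 2 * (Finset.univ.filter fun i : Fin N => i.val < k ∧ r i ≠ 0).card)

/-- auxiliary lemma `linBlindness_holds` (planner p1 g39, exp39; ported verbatim). -/
theorem linBlindness_holds : LinBlindness := fun N k r a b ha hk => linBlindness N k r a b ha hk

end Summit.QuantumAdvantage.AdviceFreeQNC0.UCoord39

/-! ## Lemma B′ (L^∞ form): JUNTA blindness — `‖Σ_x ω^{a·W_k(x)}·f(x)‖ ≤ 4·2^N/2^{k − 2 s'}` for every `f` with `‖f‖ ≤ 1`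
depending only on the letters of `T`, `s' = #{i < k : i ∈ T}` (ROUND-38 §2; same clean-coordinate Fubini, `r := 1_T`). -/
namespace Summit.QuantumAdvantage.AdviceFreeQNC0.UCoord39

open Finset Summit.QuantumAdvantage.AdviceFreeQNC0 Literature.Computability.MetaComplexity

variable {N : ℕ}

/-- The indicator vector of `T` in `(ZMod 3)^N`. -/
def indVec (T : Finset (Fin N)) : Fin N → ZMod 3 := fun i => if i ∈ T then 1 else 0

/-- auxiliary lemma `indVec_ne_zero_iff` (planner p1 g39, exp39; ported verbatim). -/
theorem indVec_ne_zero_iff (T : Finset (Fin N)) (i : Fin N) : indVec T i ≠ 0 ↔ i ∈ T := by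
  unfold indVec; split_ifs with h <;> simp [h]

/-- A clean coordinate `j` for `indVec T` is outside `T` together with its successor, so updating `u_j` does not move `x|_T`. -/
theorem xOfU_update_eq_on (T : Finset (Fin N)) (k : ℕ) (u : Fin N → Bool) (j : Fin N)
    (hj : Clean k (indVec T) j) (c : Bool) : ∀ i ∈ T, xOfU (Function.update u j c) i = xOfU u i := by
  intro i hi
  have hjT : j ∉ T := fun h => by have := hj.2.1; simp [indVec, h] at this
  have hij : i ≠ j := fun h => hjT (h ▸ hi)
  refine xOfU_congr _ _ i (Function.update_of_ne hij _ _) fun j'' hj'' => ?_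
  by_cases h : j'' = j
  · subst h
    exfalso
    have := hj.2.2 i hj''
    simp [indVec, hi] at this
  · exact Function.update_of_ne h _ _

/-- **Lemma B′ (junta blindness, L^∞ form).** -/
theorem juntaBlindness (N k : ℕ) (T : Finset (Fin N)) (f : (Fin N → Bool) → ℂ)
    (hf : ∀ x x' : Fin N → Bool, (∀ i ∈ T, x i = x' i) → f x = f x') (hf1 : ∀ x, ‖f x‖ ≤ 1)
    (a : ZMod 3) (ha : a ≠ 0) (hk : k ≤ N) :
    ‖∑ x : Fin N → Bool, (ZMod.stdAddChar (a * ((Wk x k : ℕ) : ZMod 3)) : ℂ) * f x‖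
      ≤ 4 * (2 : ℝ) ^ N / (2 : ℝ) ^ (k - 2 * (univ.filter fun i : Fin N => i.val < k ∧ i ∈ T).card) := by
  set r := indVec T with hr
  set Cl := univ.filter (Clean k r) with hCl
  set φ : Bool → ℂ := fun c => if c then (ZMod.stdAddChar a : ℂ) else 1 with hφ
  rw [sum_eq_sum_xOfU]
  have hF : ∀ u : Fin N → Bool,
      (ZMod.stdAddChar (a * ((Wk (xOfU u) k : ℕ) : ZMod 3)) : ℂ) * f (xOfU u)
        = (∏ i ∈ Cl, φ (u i)) * ((ZMod.stdAddChar (rest k r a 0 u) : ℂ) * f (xOfU u)) := by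
    intro u
    have h0 : a * ((Wk (xOfU u) k : ℕ) : ZMod 3) = a * ((Wk (xOfU u) k : ℕ) : ZMod 3) + 0 * linVal r (xOfU u) := by ring
    rw [h0, Wk_xOfU, phase_split, AddChar.map_add_eq_mul, std_cleanPart, mul_assoc]
  rw [Fintype.sum_congr _ _ hF]
  have h1 := norm_sum_prod_coord_le Cl φ (fun u => (ZMod.stdAddChar (rest k r a 0 u) : ℂ) * f (xOfU u))
    (fun u j c hj => by
      have hj' : Clean k r j := by rw [hCl, mem_filter] at hj; exact hj.2
      show (ZMod.stdAddChar (rest k r a 0 (Function.update u j c)) : ℂ) * f (xOfU (Function.update u j c))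
          = ZMod.stdAddChar (rest k r a 0 u) * f (xOfU u)
      rw [rest_update k r a 0 u j hj' c, hf _ _ (xOfU_update_eq_on T k u j hj' c)])
    (fun u => by
      rw [norm_mul, AffBells21.norm_stdAddChar_three, one_mul]; exact hf1 _)
  have hφ1 : ‖φ true + φ false‖ ≤ 1 := by
    show ‖(if true then (ZMod.stdAddChar a : ℂ) else 1) + (if false then (ZMod.stdAddChar a : ℂ) else 1)‖ ≤ 1
    rw [if_pos rfl, if_neg Bool.false_ne_true, add_comm]
    have h := TwoModuli.norm_one_add_stdAddChar_le (p := 3) ha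
    have hcos : Real.cos (Real.pi / ((3 : ℕ) : ℝ)) = 1 / 2 := by
      rw [show ((3 : ℕ) : ℝ) = 3 by norm_num, Real.cos_pi_div_three]
    rw [hcos] at h
    linarith
  have hpow : ‖φ true + φ false‖ ^ Cl.card ≤ 1 := pow_le_one₀ (norm_nonneg _) hφ1
  have h2 : ‖∑ u : Fin N → Bool, (∏ i ∈ Cl, φ (u i)) * ((ZMod.stdAddChar (rest k r a 0 u) : ℂ) * f (xOfU u))‖
      ≤ (2 : ℝ) ^ N / (2 : ℝ) ^ Cl.card := by
    refine h1.trans ?_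
    rw [mul_div_assoc]
    have hnn : (0 : ℝ) ≤ (2 : ℝ) ^ N / (2 : ℝ) ^ Cl.card := by positivity
    calc ‖φ true + φ false‖ ^ Cl.card * ((2 : ℝ) ^ N / (2 : ℝ) ^ Cl.card)
        ≤ 1 * ((2 : ℝ) ^ N / (2 : ℝ) ^ Cl.card) := mul_le_mul_of_nonneg_right hpow hnn
      _ = (2 : ℝ) ^ N / (2 : ℝ) ^ Cl.card := one_mul _
  refine h2.trans ?_
  have hcount := sub_le_card_clean r k hk
  rw [← hCl] at hcount
  have hset : (univ.filter fun i : Fin N => i.val < k ∧ r i ≠ 0) = (univ.filter fun i : Fin N => i.val < k ∧ i ∈ T) := by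
    ext i; simp only [mem_filter, mem_univ, true_and, hr, indVec_ne_zero_iff]
  rw [hset] at hcount
  have hA : (0 : ℝ) < (2 : ℝ) ^ Cl.card := by positivity
  have hB : (0 : ℝ) < (2 : ℝ) ^ (k - 2 * (univ.filter fun i : Fin N => i.val < k ∧ i ∈ T).card) := by positivity
  rw [div_le_div_iff₀ hA hB]
  have hp : (2 : ℝ) ^ (k - 2 * (univ.filter fun i : Fin N => i.val < k ∧ i ∈ T).card) ≤ (2 : ℝ) ^ (Cl.card + 2) :=
    pow_le_pow_right₀ (by norm_num) (by omega)
  have h2N : (0 : ℝ) ≤ (2 : ℝ) ^ N := by positivity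
  calc (2 : ℝ) ^ N * (2 : ℝ) ^ (k - 2 * (univ.filter fun i : Fin N => i.val < k ∧ i ∈ T).card)
      ≤ (2 : ℝ) ^ N * (2 : ℝ) ^ (Cl.card + 2) := mul_le_mul_of_nonneg_left hp h2N
    _ = 4 * (2 : ℝ) ^ N * (2 : ℝ) ^ Cl.card := by ring

/-- **Typed statement `JuntaBlindness`** (Lemma B′, L^∞ form) and its proof. -/
def JuntaBlindness : Prop :=
  ∀ (N k : ℕ) (T : Finset (Fin N)) (f : (Fin N → Bool) → ℂ),
    (∀ x x' : Fin N → Bool, (∀ i ∈ T, x i = x' i) → f x = f x') → (∀ x, ‖f x‖ ≤ 1) →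
      ∀ a : ZMod 3, a ≠ 0 → k ≤ N →
        ‖∑ x : Fin N → Bool, (ZMod.stdAddChar (a * ((Wk x k : ℕ) : ZMod 3)) : ℂ) * f x‖
          ≤ 4 * (2 : ℝ) ^ N / (2 : ℝ) ^ (k - 2 * (Finset.univ.filter fun i : Fin N => i.val < k ∧ i ∈ T).card)

/-- auxiliary lemma `juntaBlindness_holds` (planner p1 g39, exp39; ported verbatim). -/
theorem juntaBlindness_holds : JuntaBlindness :=
  fun N k T f hf hf1 a ha hk => juntaBlindness N k T f hf hf1 a ha hk

end Summit.QuantumAdvantage.AdviceFreeQNC0.UCoord39
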